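import Mathlib
import HarnessLib
import Summits.AtomisticToContinuum.BoseEinsteinCondensation.Theses.BECThomsonPrinciple
import Literature.MathematicalPhysics.QuantumManyBody.LangevinGenerator
import Literature.MathematicalPhysics.QuantumManyBody.WeightedCorrector

/-!
# Sketch — first lemmas of the crux-idea cards for `BECThomsonPrinciple.DensityResponse`
(stmt-AtomisticToContinuum-9481), ideator 2, round 1.

Card A `barta-feynman-corrector`: `BartaTilt` (Barta's supersolution inequality with the
exponential tilt `e^{sB}Θ`; with `B` the exact Poisson corrector `L_Θ B = -V` the residual bound
`R` is `0` and DensityResponse follows from a sup bound `G ≤ C N/(k²+ρa)` on `|∇B|²`).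

Card B `ballistic-transport-information`: `OneBodyTransportInformation` (the scale-`ℓ` one-body
transport–information inequality for the weight `Θ²`) and `transportInformation_densityResponse`
(it implies the DensityResponse chord for real tilted states `hΘ`, constant `8 K k² N`).
-/

open Literature.MathematicalPhysics.QuantumManyBody.BoseGas MeasureTheory

namespace Summit.AtomisticToContinuum.BoseEinsteinCondensation.Cruxes.DensityResponse.Ideas

/-- The cosine density source `V_n(X) = ∑ᵢ 2 cos((2π/L) n·xᵢ)` of `DensityResponse`. -/
noncomputable def densitySource (N : ℕ) (L : ℝ) (n : Fin 3 → ℤ) (X : Config N) : ℝ :=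
  ∑ i : Fin N, 2 * Real.cos (2 * Real.pi / L * ∑ j : Fin 3, (n j : ℝ) * X i j)

/-- **Card A, first lemma (Barta + exponential tilt).** `Θ > 0` a `C²` lattice-periodic symmetric
solution of the periodic Schrödinger equation in Riccati form (`localKinetic (-log Θ) + W = E`
pointwise, i.e. `(-ΔΘ + WΘ)/Θ = E`), `B` any real `C²` periodic symmetric tilt, `s ≥ 0`; if the
corrector residual `L_Θ B + V ≤ R` and the carré du champ `|∇B|² ≤ G` pointwise, then for every
periodic trial state `Φ`: `E - sR - s²G + s ∫ V |Φ|² ≤ ⟨Φ, (H) Φ⟩`. (Ground-state substitution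
`Φ = e^{sB}Θ g`: `⟨Φ,HΦ⟩ = ∫ e^{2sB}Θ²|∇g|² + ∫ (E - s L_Θ B - s²|∇B|²)|Φ|²`.) -/
def BartaTilt : Prop :=
  ∀ (N : ℕ) (L : ℝ), 0 < L → ∀ (v : ℝ → ENNReal) (Θ B : Config N → ℝ) (E R G s : ℝ)
    (n : Fin 3 → ℤ), 0 ≤ s →
    ContDiff ℝ 2 Θ → ContDiff ℝ 2 B → IsLatticePeriodic L Θ → IsLatticePeriodic L B →
    (∀ (σ : Equiv.Perm (Fin N)) (X : Config N), Θ (X ∘ σ) = Θ X) →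
    (∀ (σ : Equiv.Perm (Fin N)) (X : Config N), B (X ∘ σ) = B X) →
    (∀ X, 0 < Θ X) → (∀ X : Config N, periodicInteraction v L X ≠ ⊤) →
    (∀ X, localKinetic (fun Y => -Real.log (Θ Y)) X + (periodicInteraction v L X).toReal = E) →
    (∀ X, langevinGen Θ B X + densitySource N L n X ≤ R) →
    (∀ X, gradDot B B X ≤ G) →
    ∀ Φ : PeriodicTrialState N L, periodicEnergy v Φ ≠ ⊤ →
      E - s * R - s ^ 2 * G + s * ∫ X in cellN N L, densitySource N L n X * ‖Φ.ψ X‖ ^ 2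
        ≤ (periodicEnergy v Φ).toReal

/-- **Card A, target shape (the crux it leaves).** Sup-norm Feynman bound for an exact corrector:
for the data of `BartaTilt` with `R = 0` one can take `G = C N / (k² + ρ a)`; recorded as the
statement "there is a tilt `B` with `L_Θ B = -V_n` and `|∇B|² ≤ C N/(k²+ρa)`" for the (unique,
positive) periodic ground state `Θ`. Feynman's single-mode corrector `V_n/e_k` has
`|∇(V_n/e_k)|² = 4k² ∑ sin² /e_k² ≤ 4N/(k²+16πρa)` pointwise. -/
def FeynmanCorrectorSup : Prop :=
  ∀ v : ℝ → ENNReal, IsRepulsiveFiniteRange v → (∃ Bv : ℝ, ∀ r, v r ≤ ENNReal.ofReal Bv) →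
    ∀ M : ℝ, 0 < M → ∃ ρ₀ C : ℝ, 0 < ρ₀ ∧ 0 < C ∧ ∃ N₀ : ℕ, ∀ N : ℕ, N₀ ≤ N → ∀ L : ℝ, 0 < L →
    (N : ℝ) ≤ ρ₀ * L ^ 3 → ∀ n : Fin 3 → ℤ, n ≠ 0 →
    2 * Real.pi * ‖(fun j => (n j : ℝ))‖ / L ≤ M * Real.sqrt (N / L ^ 3) →
    ∀ (Θ : Config N → ℝ) (E : ℝ), ContDiff ℝ 2 Θ → IsLatticePeriodic L Θ →
    (∀ (σ : Equiv.Perm (Fin N)) (X : Config N), Θ (X ∘ σ) = Θ X) → (∀ X, 0 < Θ X) →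
    (∀ X, localKinetic (fun Y => -Real.log (Θ Y)) X + (periodicInteraction v L X).toReal = E) →
    ∃ B : Config N → ℝ, ContDiff ℝ 2 B ∧ IsLatticePeriodic L B ∧
      (∀ (σ : Equiv.Perm (Fin N)) (X : Config N), B (X ∘ σ) = B X) ∧
      (∀ X, langevinGen Θ B X + densitySource N L n X = 0) ∧
      ∀ X, gradDot B B X ≤ C * N / ((2 * Real.pi * ‖(fun j => (n j : ℝ))‖ / L) ^ 2
        + N / L ^ 3 * (scatteringLength v).toReal)

/-- **Card B, the object.** Scale-`ℓ` ONE-BODY TRANSPORT–INFORMATION inequality with constant `K`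
for the weight `Θ` on the `N`-torus of side `L`: for every one-body `C¹` periodic observable `u`
with `|∇u|² ≤ g₁`, `u² ≤ g₀` pointwise and every real `C¹` periodic symmetric tilt `h` with
`∫ h²Θ² = 1`, the shift of the additive observable `U = ∑ᵢ u(xᵢ)` under `h²Θ²` is controlled by the
Dirichlet form (Fisher information): `(∫ U h²Θ² - ∫ U Θ²)² ≤ K · N (g₁ + g₀/ℓ²) · 𝓔_Θ(h,h)`.
(Tested/Kantorovich-dual form of `W₁,ℓ(h²Θ², Θ²)² ≤ K·I`, GLWY's `W₁I`.) The card's claim: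
for the periodic ground state, `K ≤ C ℓ²/(ρ a)` for `ℓ` between the healing length and `L`
(ballistic), against the free value `ℓ⁴` (diffusive). -/
def OneBodyTransportInformation (N : ℕ) (L ℓ K : ℝ) (Θ : Config N → ℝ) : Prop :=
  ∀ (u : Space → ℝ) (g₀ g₁ : ℝ), ContDiff ℝ 1 u →
    (∀ (x : Space) (a : Fin 3), u (x + EuclideanSpace.single a L) = u x) →
    (∀ x, u x ^ 2 ≤ g₀) → (∀ x, ‖fderiv ℝ u x‖ ^ 2 ≤ g₁) →
    ∀ h : Config N → ℝ, IsPeriodicTest L h →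
    (∀ (σ : Equiv.Perm (Fin N)) (X : Config N), h (X ∘ σ) = h X) →
    (∫ X in cellN N L, h X ^ 2 * Θ X ^ 2) = 1 →
    (∫ X in cellN N L, (∑ i, u (X i)) * (h X ^ 2 * Θ X ^ 2)
        - ∫ X in cellN N L, (∑ i, u (X i)) * Θ X ^ 2) ^ 2
      ≤ K * N * (g₁ + g₀ / ℓ ^ 2) * dirichletFormW L Θ h h

/-- **Card B, first lemma.** The scale-`1/k` one-body transport–information inequality for a
positive normalised periodic Schrödinger solution `Θ` (Riccati form, eigenvalue `E`, source mean
zero) gives the DensityResponse chord for the real tilted trial states `Φ = hΘ`, constant `2 K k² N`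
(ground-state representation `⟨hΘ, H hΘ⟩ = E + 𝓔_Θ(h,h)` from the Riccati equation by one
integration by parts on the torus, then AM–GM `s·|∫V h²Θ²| ≤ s √(8Kk²N 𝓔) ≤ 𝓔 + 2Kk²N s²`);
with `K ≤ C'/(k²(k²+ρa))` this is DensityResponse's `C N/(k²+ρa)` on real nonnegative states
(complex `Φ`: diamagnetic reduction, or card A). -/
def TransportInformationDensityResponse : Prop :=
  ∀ (N : ℕ) (L : ℝ), 0 < L → ∀ (v : ℝ → ENNReal) (Θ : Config N → ℝ) (E K : ℝ) (n : Fin 3 → ℤ),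
    n ≠ 0 → 0 ≤ K → ContDiff ℝ 2 Θ → IsLatticePeriodic L Θ →
    (∀ (σ : Equiv.Perm (Fin N)) (X : Config N), Θ (X ∘ σ) = Θ X) → (∀ X, 0 < Θ X) →
    (∫ X in cellN N L, Θ X ^ 2) = 1 → (∀ X : Config N, periodicInteraction v L X ≠ ⊤) →
    (∀ X, localKinetic (fun Y => -Real.log (Θ Y)) X + (periodicInteraction v L X).toReal = E) →
    (∫ X in cellN N L, densitySource N L n X * Θ X ^ 2) = 0 →
    OneBodyTransportInformation N L (L / (2 * Real.pi * ‖(fun j => (n j : ℝ))‖)) K Θ →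
    ∀ (s : ℝ), 0 ≤ s → ∀ h : Config N → ℝ, IsPeriodicTest L h →
    (∀ (σ : Equiv.Perm (Fin N)) (X : Config N), h (X ∘ σ) = h X) →
    ∀ Φ : PeriodicTrialState N L, (∀ X, Φ.ψ X = ((h X * Θ X : ℝ) : ℂ)) →
    periodicEnergy v Φ ≠ ⊤ →
      E + s * |∫ X in cellN N L, densitySource N L n X * ‖Φ.ψ X‖ ^ 2|
        ≤ (periodicEnergy v Φ).toReal
          + 2 * K * (2 * Real.pi * ‖(fun j => (n j : ℝ))‖ / L) ^ 2 * N * s ^ 2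

end Summit.AtomisticToContinuum.BoseEinsteinCondensation.Cruxes.DensityResponse.Ideas
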